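import Mathlib
import Literature.Analysis.FluidPDE.KNSSLineInvariantLiouville
import Literature.Analysis.FluidPDE.KNSSTypeIRateLimit
import Literature.Analysis.FluidPDE.BlowupAncientSolution
import Summits.NavierStokesRegularity.OSWSelfSimilar.TypeIIInnerLimitCaseB
import HarnessLib
/-!
# Case B end to end: a zoom along receding axes has a constant inner limit (zone Z1 TEMPLATE §T1.4-I (I-3), kernel)

HONEST FRAMING (cell ns-blowup GROUP B «PROFILE SEARCH», zone Z1; D-0035/D-0074): part XV of the Z1 dictionary, the
composition promised in part XIV's docstring. TEMPLATE (I-3): «Case B (`d_n → ∞`): W is invariant under translations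
along one horizontal direction (rings of rescaled radius `d_n → ∞` are locally straight) … ⇒ `W ≡ const`.» BOTH halves
are tree theorems: the geometric half is `Literature.Analysis.FluidPDE.eq_of_tendstoLocallyUniformly_of_rot_about`
(`KNSSTypeIRateLimit`: a locally uniform limit of fields axisymmetric about the vertical axes through `−M_k e₀`, `M_k → ∞`,
does not depend on `x₁` — KNSS 2009, proof of Thm 6.2, p. 13 «it is easy to see that w is independent of the
x₂-variable», PROVED there), the Liouville half is `Literature.Analysis.FluidPDE.apply_eq_apply_zero_of_lineInvariant`
(`KNSSLineInvariantLiouville`, this seat: the 2½-D Liouville theorem). This file composes them on the template's zoom: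

* `zoom_rot_about` — **the zoom of an axisymmetric field about an off-axis meridional centre is axisymmetric about a
  receding axis**: if `U` is axisymmetric (standard axis) and `x_c = r e₀ + z e₂` lies in the meridional half-plane, then
  `V(y) = λ • U(x_c + λ • y)` satisfies `V(c + R_θ(y − c)) = R_θ V(y)` with `c = −(r/λ) e₀` — the hypothesis shape of the
  tree's sliding lemma with `M = r/λ = d` (TEMPLATE's rescaled distance to the axis);
* `zoomLimit_lineInvariant_of_receding_axis` — slice-wise: locally uniform limits along `M_k → ∞` are `e₁`-invariant;
* `zoomLimit_apply_eq_of_receding_axis` — **Case B ⇒ constant**: if moreover the limit `W` is a bounded ancient mild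
  solution (duality class, `ν = 1`) jointly continuous on `(−∞, 0) × ℝ³`, then `W(s, y) = W(s, 0)` for all `s < 0`;
* `knssBlowupLimit_apply_eq_of_receding_axis` / `knssBlowupLimit_curl_eq_zero_of_receding_axis` — the same for the
  (I-2) inner object `IsKNSSBlowupLimit`, and its vorticity vanishes: **a Case-B inner limit is of type (I-4)(α)**;
* `knssBlowupLimit_not_receding_of_not_const` — contrapositive: a KNSS blow-up limit with one non-constant slice is NOT
  the locally uniform limit of a zoom along receding axes — **type (β) forces Case A** (catalogue (C6)).

What stays PAPER: only that the KNSS extraction (tree: `KNSS2009_blowup_generates_ancient_holds`, which returns the limit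
but not the family) converges LOCALLY UNIFORMLY slice-wise along the chosen centres — the mode of convergence is inside the
tree's proof, not in the fact's statement. **Nothing here asserts that a blow-up or a zoom limit exists.** «violates: n/a —
dictionary»; bears_on LADDER-NS N5/Z1 → N1 linear core / N0⁻ ((I-3)/(I-4)/(C6)). Author: ns-blowup-profile-eng-1 g7,
2026-08-27.
-/

open Real Filter Topology Set MeasureTheory Function
open Literature.Analysis.FluidPDE

namespace Summit.NavierStokesRegularity.OSWSelfSimilar
namespace TypeIIModulationDictionary

section Zoom

/-- **The zoom about an off-axis meridional centre is axisymmetric about a receding axis.** Let `U` be axisymmetric about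
the standard axis and `x_c = r e₀ + z e₂` (a centre in the meridional half-plane `{x₁ = 0}`), `λ ≠ 0`. Then the rescaled
field `V(y) = λ • U(x_c + λ • y)` is axisymmetric about the vertical axis through `c = −(r/λ) e₀`:
`V(c + R_θ(y − c)) = R_θ V(y)` — the hypothesis of the tree's `eq_of_tendstoLocallyUniformly_of_rot_about` with
`M = r/λ`, the TEMPLATE's rescaled distance `d` of the centre from the axis. [new here — dictionary] -/
theorem zoom_rot_about {U : EuclideanSpace ℝ (Fin 3) → EuclideanSpace ℝ (Fin 3)} (hU : IsAxisymmetric U)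
    {lam r z : ℝ} (hlam : lam ≠ 0) (θ : ℝ) (y : EuclideanSpace ℝ (Fin 3)) :
    lam • U (EuclideanSpace.single 0 r + EuclideanSpace.single 2 z +
        lam • ((EuclideanSpace.single 0 (-(r / lam)) : EuclideanSpace ℝ (Fin 3)) +
          rotZ θ (y - EuclideanSpace.single 0 (-(r / lam))))) =
      rotZ θ (lam • U (EuclideanSpace.single 0 r + EuclideanSpace.single 2 z + lam • y)) := by
  -- the argument on the left is `R_θ` of the argument on the right (the axis point `z e₂` is fixed by `R_θ`)
  have harg : EuclideanSpace.single 0 r + EuclideanSpace.single 2 z +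
      lam • ((EuclideanSpace.single 0 (-(r / lam)) : EuclideanSpace ℝ (Fin 3)) +
        rotZ θ (y - EuclideanSpace.single 0 (-(r / lam)))) =
      rotZ θ (EuclideanSpace.single 0 r + EuclideanSpace.single 2 z + lam • y) := by
    ext i
    fin_cases i <;> simp [rotZ_apply_zero, rotZ_apply_one, rotZ_apply_two] <;> field_simp <;> ring
  rw [harg, hU θ, ← rotZL_apply, ← rotZL_apply, map_smul]

variable {V : ℕ → ℝ → EuclideanSpace ℝ (Fin 3) → EuclideanSpace ℝ (Fin 3)}
  {W : ℝ → EuclideanSpace ℝ (Fin 3) → EuclideanSpace ℝ (Fin 3)} {M : ℕ → ℝ}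

/-- **Slice-wise: a locally uniform limit of a zoom along receding axes is `e₁`-invariant** (the tree's
`eq_of_tendstoLocallyUniformly_of_rot_about`, KNSS 2009 p. 13, read at every `s < 0`). [new here — dictionary] -/
theorem zoomLimit_lineInvariant_of_receding_axis (hM : Tendsto M atTop atTop)
    (hsym : ∀ k, ∀ s < 0, ∀ (θ : ℝ) (y : EuclideanSpace ℝ (Fin 3)),
      V k s (EuclideanSpace.single 0 (-M k) + rotZ θ (y - EuclideanSpace.single 0 (-M k))) = rotZ θ (V k s y))
    (hconv : ∀ s < 0, TendstoLocallyUniformly (fun k => V k s) (W s) atTop)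
    (hWc : ∀ s < 0, Continuous (W s)) :
    ∀ s < 0, ∀ (y : EuclideanSpace ℝ (Fin 3)) (δ : ℝ), W s (y + EuclideanSpace.single 1 δ) = W s y :=
  fun s hs y δ => eq_of_tendstoLocallyUniformly_of_rot_about hM (fun k θ x => hsym k s hs θ x) (hconv s hs) (hWc s hs) y δ

/-- **TEMPLATE (I-3), Case B end to end: the inner limit of a zoom along receding axes is constant in space.** If the
slices `V_k(s, ·)` are axisymmetric about the vertical axes through `−M_k e₀` with `M_k → ∞` (`zoom_rot_about`),
converge locally uniformly to `W(s, ·)` for every `s < 0`, and the limit `W` is a bounded ancient mild solution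
(`ν = 1`, duality class) jointly continuous on `(−∞, 0) × ℝ³`, then `W(s, y) = W(s, 0)`: sliding lemma + 2½-D Liouville,
both tree theorems resting on discharged KNSS 2009 results. [new here — dictionary] -/
theorem zoomLimit_apply_eq_of_receding_axis (hM : Tendsto M atTop atTop)
    (hsym : ∀ k, ∀ s < 0, ∀ (θ : ℝ) (y : EuclideanSpace ℝ (Fin 3)),
      V k s (EuclideanSpace.single 0 (-M k) + rotZ θ (y - EuclideanSpace.single 0 (-M k))) = rotZ θ (V k s y))
    (hconv : ∀ s < 0, TendstoLocallyUniformly (fun k => V k s) (W s) atTop)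
    (hW : IsBoundedAncientMildSolution 1 W) (hcont : ContinuousOn (uncurry W) (Iio 0 ×ˢ univ)) :
    ∀ s < 0, ∀ y : EuclideanSpace ℝ (Fin 3), W s y = W s 0 :=
  apply_eq_apply_zero_of_lineInvariant hW hcont
    (zoomLimit_lineInvariant_of_receding_axis hM hsym hconv fun _ hs => continuous_slice_of_continuousOn_Iio hcont hs)

/-- **The same for the (I-2) inner object** `IsKNSSBlowupLimit` (smooth bounded ancient mild, `|W| ≤ 1 = sup`): a KNSS
blow-up limit obtained as the locally uniform slice-wise limit of a zoom along receding axes is constant in space on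
every slice. [new here — dictionary] -/
theorem knssBlowupLimit_apply_eq_of_receding_axis (hM : Tendsto M atTop atTop)
    (hsym : ∀ k, ∀ s < 0, ∀ (θ : ℝ) (y : EuclideanSpace ℝ (Fin 3)),
      V k s (EuclideanSpace.single 0 (-M k) + rotZ θ (y - EuclideanSpace.single 0 (-M k))) = rotZ θ (V k s y))
    (hconv : ∀ s < 0, TendstoLocallyUniformly (fun k => V k s) (W s) atTop) (hW : IsKNSSBlowupLimit W) :
    ∀ s < 0, ∀ y : EuclideanSpace ℝ (Fin 3), W s y = W s 0 :=
  zoomLimit_apply_eq_of_receding_axis hM hsym hconv hW.isBoundedAncientMildSolution hW.smooth.continuousOn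

/-- **A Case-B inner limit carries no vorticity** (type (I-4)(α)): under the hypotheses of
`knssBlowupLimit_apply_eq_of_receding_axis`, `curl W(s) ≡ 0`. [new here — dictionary] -/
theorem knssBlowupLimit_curl_eq_zero_of_receding_axis (hM : Tendsto M atTop atTop)
    (hsym : ∀ k, ∀ s < 0, ∀ (θ : ℝ) (y : EuclideanSpace ℝ (Fin 3)),
      V k s (EuclideanSpace.single 0 (-M k) + rotZ θ (y - EuclideanSpace.single 0 (-M k))) = rotZ θ (V k s y))
    (hconv : ∀ s < 0, TendstoLocallyUniformly (fun k => V k s) (W s) atTop) (hW : IsKNSSBlowupLimit W) :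
    ∀ s < 0, ∀ y : EuclideanSpace ℝ (Fin 3), curl (W s) y = 0 :=
  knssBlowupLimit_curl_eq_zero_of_lineInvariant hW
    (zoomLimit_lineInvariant_of_receding_axis hM hsym hconv fun _ hs =>
      continuous_slice_of_continuousOn_Iio hW.smooth.continuousOn hs)

/-- **Type (β) forces Case A** (TEMPLATE (I-3) last sentence / catalogue (C6), as a theorem): a KNSS blow-up limit with
ONE non-constant slice is not the locally uniform slice-wise limit of any zoom whose slices are axisymmetric about
vertical axes receding to infinity. [new here — dictionary] -/
theorem knssBlowupLimit_not_receding_of_not_const (hW : IsKNSSBlowupLimit W)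
    (hnc : ∃ s < 0, ∃ y : EuclideanSpace ℝ (Fin 3), W s y ≠ W s 0) (hM : Tendsto M atTop atTop)
    (hsym : ∀ k, ∀ s < 0, ∀ (θ : ℝ) (y : EuclideanSpace ℝ (Fin 3)),
      V k s (EuclideanSpace.single 0 (-M k) + rotZ θ (y - EuclideanSpace.single 0 (-M k))) = rotZ θ (V k s y)) :
    ¬ ∀ s < 0, TendstoLocallyUniformly (fun k => V k s) (W s) atTop := by
  intro hconv
  obtain ⟨s, hs, y, hy⟩ := hnc
  exact hy (knssBlowupLimit_apply_eq_of_receding_axis hM hsym hconv hW s hs y)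

end Zoom

end TypeIIModulationDictionary
end Summit.NavierStokesRegularity.OSWSelfSimilar
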